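/-
Copyright (c) 2026 the pub-hodgecm-mathlib formalisation cell (harness21).  Prover seat hodgecm-mathlib-F0P3b-p01 (g11), 2026-09-01.  Road «S3-tree» (census «S3» v3, architect
A-p16 (g29) A-61∕A-65), brick T3′ «depth-zero κ-transfer», organ O8d-alg of the holder's O8 sub-deal: the 2×3 MATRIX IDENTITY as pure arithmetic in `ℚ` — from the three κ-sums
(unit at `(N₁,N₂,N)`, unit at the SHIFTED `(N₁−1,N₂−1,N−1)`, and the FREE∕regular-unipotent count `(q+1)²q^{S−2}` on the parity class) to the two H-side columns `W(N−1)`, `w_N`.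
-/
import Literature.NumberTheory.Rogawski1990.UnitFundamentalLemmaInertFlickerAlgebra   -- ★ `phiH`, `phiKappa`, `flicker_theorem15`
import HarnessLib

/-!
# The depth-zero `2×3` matrix (L4) as an identity of κ-sums: `Δ‴·Σ_c κ(c)·Σ_r c_r n_r(c) = a₀·W(N−1) + a₁·w_N`

Topic `NumberTheory/Rogawski1990`; namespace `Literature.NumberTheory.Rogawski1990.Flicker1998`.  THEOREMS ONLY (no definition, no instance, no notation, no named fact, no `sorry`);
pure arithmetic in `ℚ` over ★ `phiH` (`W(N) = Φ^st(1_{K_H})(N) = ((q+1)q^N − 2)∕(q−1)`).  Cell `pub/hodgecm-mathlib`, crux H413 = `stmt-HodgeConjecture-24833`; road «S3-tree», brick T3′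
(holder F0P3b-p01 (g11); DESIGN v1 419b4e54 §1; HEAD v3 6242f031: `a₀ = q⁻² c 0 + ((q²−1)∕q²) c 1`, `a₁ = −q⁻¹ c 1 + ((q+1)∕q) c 2`), organ **O8d-alg**: the last, purely
algebraic step of the assembly O8d, stated with the three κ-SUMS AS HYPOTHESES (each discharged by name elsewhere: `ΣκN_0 = (−q)^{N₁+N₂}W(N)` = ★ `flicker_theorem15`; `Σκn₀ =
(−q)^{N₁+N₂−2}W(N−1)` = the same at the shifted exponents via T4′(b)∕Cayley; `Σκn₂ = (−1)^{N₁+N₂}(q+1)²q^{N₁+N₂+N−2}` = ★ O8a (torsor count + parity + O1–O4)).  HONEST LABEL: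
HC_CM is proved only modulo the cell's 2 remaining named inputs (hLiu418, h413) until rung 0 closes; this file is arithmetic and asserts nothing printed.

THE IDENTITY.  With `Δ := (−q)^{−(N₁+N₂)}`, `K₀ := Σ_c κ(c) n₀(c)`, `K := Σ_c κ(c) (n₀+n₁+n₂)(c)`, `K₂ := Σ_c κ(c) n₂(c)` and the VALUE of the piece `X(c) = Σ_r c_r n_r(c)` (so that
`Σ_c κ X = c₀K₀ + c₁(K − K₀ − K₂) + c₂K₂`):
  `Δ · (c₀K₀ + c₁(K − K₀ − K₂) + c₂K₂) = (q⁻²c₀ + ((q²−1)∕q²)c₁) · W(N−1) + (−q⁻¹c₁ + ((q+1)∕q)c₂) · w_N`,  `w_N = W(N) − W(N−1) = q^{N−1}(q+1)` (`N ≥ 1`).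
* `phiH_sub_phiH_pred` — `W(N) − W(N−1) = q^{N−1}(q+1)`;  `depthZero_matrix_identity` — the displayed identity;  `depthZero_matrix_identity_rows` — the three rows of
  `M = [[q⁻², 0], [(q²−1)∕q², −1∕q], [0, (q+1)∕q]]` separately (`c = e_r`).

## References
* [Rogawski1990] J. D. Rogawski, *Automorphic Representations of Unitary Groups in Three Variables* (1990), §4.9 Prop. 4.9.1 (a)(b) p. 55; §8.1 Prop. 8.1.1 p. 112.
* [Flicker1998UnitaryFL] Y. Z. Flicker, *Elementary proof of the fundamental lemma for a unitary group*, Canad. J. Math. 50 (1998), §6 Thm. 15 p. 95 (the unit row `Σ = (1,1)`).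
-/

set_option autoImplicit false

namespace Literature.NumberTheory.Rogawski1990.Flicker1998

/-- **`W(N) − W(N−1) = w_N = q^{N−1}(q+1)`** (`N ≥ 1`, `q ≠ 1`): the number of fixed `W`-vertices of exact depth `N`. [cite: Flicker1998UnitaryFL, §6 p. 95] -/
theorem phiH_sub_phiH_pred {q : ℕ} (hq : 1 < q) {N : ℕ} (hN : 1 ≤ N) :
    phiH q N - phiH q (N - 1) = (q : ℚ) ^ (N - 1) * (q + 1) := by
  obtain ⟨M, rfl⟩ : ∃ M, N = M + 1 := ⟨N - 1, by omega⟩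
  have hq1 : (q : ℚ) - 1 ≠ 0 := by
    have h1q : (1 : ℚ) < q := by exact_mod_cast hq
    exact sub_ne_zero.2 (ne_of_gt h1q)
  rw [Nat.add_sub_cancel, phiH, phiH, pow_succ]
  field_simp
  ring

/-- **THE DEPTH-ZERO MATRIX IDENTITY** (see the module docstring): from the three κ-sums to the two H-columns, for arbitrary stratum values `c₀ c₁ c₂`; deep data
(`N₁, N₂, N ≥ 1`). [cite: Rogawski1990, §4.9 Prop. 4.9.1 (a) p. 55; §8.1 Prop. 8.1.1 p. 112] [cite: Flicker1998UnitaryFL, §6 Thm. 15 p. 95] -/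
theorem depthZero_matrix_identity {q : ℕ} (hq : 1 < q) {N₁ N₂ N : ℕ} (h₁ : 1 ≤ N₁) (h₂ : 1 ≤ N₂) (hN : 1 ≤ N) {K₀ K K₂ : ℚ} (c₀ c₁ c₂ : ℚ)
    (hK : K = (-(q : ℚ)) ^ (N₁ + N₂) * phiH q N)
    (hK₀ : K₀ = (-(q : ℚ)) ^ (N₁ + N₂ - 2) * phiH q (N - 1))
    (hK₂ : K₂ = (-1 : ℚ) ^ (N₁ + N₂) * ((q : ℚ) + 1) ^ 2 * (q : ℚ) ^ (N₁ + N₂ + N - 2)) :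
    ((-(q : ℚ)) ^ (N₁ + N₂))⁻¹ * (c₀ * K₀ + c₁ * (K - K₀ - K₂) + c₂ * K₂) =
      (((q : ℚ) ^ 2)⁻¹ * c₀ + (((q : ℚ) ^ 2 - 1) / (q : ℚ) ^ 2) * c₁) * phiH q (N - 1) +
        (-((q : ℚ))⁻¹ * c₁ + (((q : ℚ) + 1) / (q : ℚ)) * c₂) * (phiH q N - phiH q (N - 1)) := by
  have hq0 : (q : ℚ) ≠ 0 := Nat.cast_ne_zero.2 (by omega)
  obtain ⟨A, rfl⟩ : ∃ A, N₁ = A + 1 := ⟨N₁ - 1, by omega⟩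
  obtain ⟨B, rfl⟩ : ∃ B, N₂ = B + 1 := ⟨N₂ - 1, by omega⟩
  obtain ⟨M, rfl⟩ : ∃ M, N = M + 1 := ⟨N - 1, by omega⟩
  have hw := phiH_sub_phiH_pred hq hN
  rw [Nat.add_sub_cancel] at hw hK₀ ⊢
  rw [show A + 1 + (B + 1) - 2 = A + B from by omega] at hK₀
  rw [show A + 1 + (B + 1) + (M + 1) - 2 = A + B + (M + 1) from by omega] at hK₂
  rw [show A + 1 + (B + 1) = A + B + 2 from by omega] at hK hK₂ ⊢
  -- `u := (−q)^{A+B}`; `(−q)^{A+B+2} = u q²`; `(−1)^{A+B+2} q^{A+B+M+1} = u q^{M+1}`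
  set u : ℚ := (-(q : ℚ)) ^ (A + B) with hu
  have hu0 : u ≠ 0 := pow_ne_zero _ (neg_ne_zero.2 hq0)
  have e1 : (-(q : ℚ)) ^ (A + B + 2) = u * (q : ℚ) ^ 2 := by rw [pow_add, neg_sq]
  have e2 : (-1 : ℚ) ^ (A + B + 2) * ((q : ℚ) + 1) ^ 2 * (q : ℚ) ^ (A + B + (M + 1)) = u * ((q : ℚ) + 1) ^ 2 * (q : ℚ) ^ (M + 1) := by
    rw [hu, neg_pow, pow_add (-1 : ℚ) (A + B) 2, pow_add (q : ℚ) (A + B) (M + 1)]; norm_num; ring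
  have hW : phiH q (M + 1) = phiH q M + (q : ℚ) ^ M * (q + 1) := by rw [← hw]; ring
  rw [e1] at hK ⊢
  rw [e2] at hK₂
  rw [hK, hK₀, hK₂, hW]
  field_simp
  ring

/-- **THE THREE ROWS OF `M = [[q⁻², 0], [(q²−1)∕q², −1∕q], [0, (q+1)∕q]]`** (the identity at `c = e₀, e₁, e₂`): `ΔK₀ = q⁻²W(N−1)`, `Δ(K − K₀ − K₂) = ((q²−1)∕q²)W(N−1) − q⁻¹w_N`,
`ΔK₂ = ((q+1)∕q)w_N`. [cite: Rogawski1990, §4.9 Prop. 4.9.1 (a) p. 55] [cite: Flicker1998UnitaryFL, §6 Thm. 15 p. 95] -/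
theorem depthZero_matrix_identity_rows {q : ℕ} (hq : 1 < q) {N₁ N₂ N : ℕ} (h₁ : 1 ≤ N₁) (h₂ : 1 ≤ N₂) (hN : 1 ≤ N) {K₀ K K₂ : ℚ}
    (hK : K = (-(q : ℚ)) ^ (N₁ + N₂) * phiH q N)
    (hK₀ : K₀ = (-(q : ℚ)) ^ (N₁ + N₂ - 2) * phiH q (N - 1))
    (hK₂ : K₂ = (-1 : ℚ) ^ (N₁ + N₂) * ((q : ℚ) + 1) ^ 2 * (q : ℚ) ^ (N₁ + N₂ + N - 2)) :
    ((-(q : ℚ)) ^ (N₁ + N₂))⁻¹ * K₀ = ((q : ℚ) ^ 2)⁻¹ * phiH q (N - 1) ∧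
      ((-(q : ℚ)) ^ (N₁ + N₂))⁻¹ * (K - K₀ - K₂) =
        (((q : ℚ) ^ 2 - 1) / (q : ℚ) ^ 2) * phiH q (N - 1) - ((q : ℚ))⁻¹ * (phiH q N - phiH q (N - 1)) ∧
      ((-(q : ℚ)) ^ (N₁ + N₂))⁻¹ * K₂ = (((q : ℚ) + 1) / (q : ℚ)) * (phiH q N - phiH q (N - 1)) := by
  have r0 := depthZero_matrix_identity hq h₁ h₂ hN 1 0 0 hK hK₀ hK₂
  have r1 := depthZero_matrix_identity hq h₁ h₂ hN 0 1 0 hK hK₀ hK₂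
  have r2 := depthZero_matrix_identity hq h₁ h₂ hN 0 0 1 hK hK₀ hK₂
  simp only [one_mul, zero_mul, mul_one, mul_zero, add_zero, zero_add] at r0 r1 r2
  refine ⟨r0, ?_, r2⟩
  rw [r1]
  ring

end Literature.NumberTheory.Rogawski1990.Flicker1998
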